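import Literature.NumberTheory.EllipticCurves.CuspFormTwistModularSymbol
import Summits.BirchSwinnertonDyer.BirchSwinnertonDyer.Theorems.ManinLocalTwoThreeManinPrimeToAdditiveFiveLeHorocyclicTransfer
import HarnessLib

/-!
# Route `ManinLocalTwoThree`, residual crux C5 `ManinPrimeToAdditiveFiveLe` (stmt-BirchSwinnertonDyer-22969),
# registered stub `stub_ord57` (stmt-27552), line «horocyclic-orientation», support stub
# `stub_notBottom_of_horocyclic57`, part 2/3: **BOTTOM(f, χ) forces the horocyclic `k`-th differences of the
# modular symbol of `f` into `p·Λ_f`** (curve-free, route-independent: a theorem about `S₂(Γ₀(N))`)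

Width seat bsd-line-ml23-c5-p1-w3 (gen 3). For `f ∈ S₂(Γ₀(N))`, an odd prime `p` with `N ∣ L`, `p² ∣ L`, a quadratic
character `χ` mod `p` with the Legendre values (`χ(u) = χ_p(u)`; for the quadratic PRIMITIVE character this is the
tree's `dirichletCharacter_eq_quadraticChar_of_isQuadratic_of_isPrimitive`, used in part 3/3), and BOTTOM(`f`, `χ`):
`g(χ)·w ∈ p·Λ_f` for every period `w` of `f ⊗ χ ∈ S₂(Γ₀(L))` — for all `A, C` with `L ∣ C ≠ 0`, `gcd(A, C) = 1`,
`p ∣ A² − 1`:  **`Δ^k_{1/p}{∞, A/C}_f := Σ_{i≤k} (−1)^i C(k,i) {∞, A/C + i/p}_f ∈ p·Λ_f`**, `k = (p−1)/2`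
(`horocyclicDifference_mem_of_bottom`). Mechanism: complete `(A, C)` to `γ ∈ Γ₀(L)`; `p ∣ D − A`; the conjugates
`γ_n = u_n γ u_n⁻¹ ∈ Γ₀(L)`, `u_n = (1 n/p; 0 1)`, have `γ_n∞ = A/C + n/p`, so `h(n) := {∞, A/C + n/p}_f =
{∞, γ_n ∞}_f ∈ Λ_f` is `p`-periodic; BOTTOM at `w = {∞, γ_j∞}_{f⊗χ}` and `modularSymbol_charTwist` (Shimura 3.64
integrated, MTT §I.8) give `Σ_u χ(u) h(j+u) ∈ p·Λ_f` for all `j`; part 1/3 `horocyclic_transfer_abstract` concludes.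

Nothing about C5, K18b″ (27662), Manin's conjecture or BSD is proved in this file.

References: [Shimura1971] Prop. 3.64; [MazurTateTeitelbaum1986Invent] §I.8; [Manin1972] §1.2, Prop. 1.4, Thm. 1.6;
[EdixhovenManin1991] §4 (case 1).
-/

set_option autoImplicit false
-- the Theorems namespace of this sub repeats the summit name by design (D-0017 nested layout)
set_option linter.dupNamespace false

noncomputable section

open scoped Classical

namespace Summit.BirchSwinnertonDyer.BirchSwinnertonDyer.Theorems

open Finset

/-! ## §4 BOTTOM forces the horocyclic differences into `p·Λ_f` -/

section ModularSymbols

open scoped MatrixGroups ModularForm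

open CongruenceSubgroup Literature.NumberTheory.EllipticCurves.ModularForms

/-- **BOTTOM ⟹ the horocyclic `k`-th difference is divisible by `p` in `Λ_f`.** Let `f ∈ S₂(Γ₀(N))`, `p` an odd
prime, `N ∣ L`, `p² ∣ L`, `χ` a quadratic character mod `p` with the Legendre values and `g(χ) ≠ 0` (e.g. the
quadratic primitive character mod `p`), and suppose BOTTOM(`f`, `χ`):
`g(χ)·w ∈ p·Λ_f` for every period `w` of `f ⊗ χ ∈ S₂(Γ₀(L))`. Then for all integers `A, C` with `L ∣ C ≠ 0`,
`gcd(A, C) = 1`, `p ∣ A² − 1`:  `Σ_{i ≤ k} (−1)^i C(k,i) {∞, A/C + i/p}_f ∈ p·Λ_f`, `k = (p−1)/2`.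
Proof: complete `(A, C)` to `γ = (A B; C D) ∈ Γ₀(L)`; `p ∣ D − A`; `γ_n := u_n γ u_n⁻¹ =
(A + nC/p, B + n(D−A)/p − n²C/p²; C, D − nC/p) ∈ Γ₀(L)` has `γ_n ∞ = A/C + n/p`, so `h(n) := {∞, A/C + n/p}_f =
{∞, γ_n∞}_f ∈ Λ_f` is `p`-periodic (`{∞, r+1} = {∞, r}`); BOTTOM at `w = {∞, γ_j ∞}_{f⊗χ}` and
`{∞, r}_{f⊗χ} = g(χ)⁻¹ Σ_u χ(u) {∞, r + u/p}_f` (`modularSymbol_charTwist`) give `Σ_u χ(u) h(j+u) ∈ pΛ_f`; conclude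
by part 1/3 `horocyclic_transfer_abstract`.
[cite: Shimura1971, Prop. 3.64] [cite: MazurTateTeitelbaum1986Invent, §I.8] [cite: Manin1972, Prop. 1.4  Thm. 1.6] -/
theorem horocyclicDifference_mem_of_bottom {N L : ℕ} [NeZero N] [NeZero L] (f : CuspForm (Gamma0 N) 2)
    {p : ℕ} [hp : Fact p.Prime] (hp2 : p ≠ 2) (hN : N ∣ L) (hm : p ^ 2 ∣ L)
    {χ : DirichletCharacter ℂ p} (hχ : χ.IsQuadratic)
    (hχL : ∀ u : ZMod p, χ u = ((quadraticChar (ZMod p) u : ℤ) : ℂ))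
    (hg : gaussSum χ (ZMod.stdAddChar (N := p)) ≠ 0)
    (hbot : ∀ w ∈ periodLattice (charTwist L hN hm hχ f), ∃ y ∈ periodLattice f,
      gaussSum χ (ZMod.stdAddChar (N := p)) * w = (p : ℂ) * y)
    (A C : ℤ) (hLC : (L : ℤ) ∣ C) (hC : C ≠ 0) (hAC : IsCoprime A C) (hA : (p : ℤ) ∣ A * A - 1) :
    ∃ y ∈ periodLattice f, (∑ i ∈ Finset.range ((p - 1) / 2 + 1),
      ((((-1 : ℤ) ^ i * (((p - 1) / 2).choose i : ℕ)) : ℤ) : ℂ) *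
        modularSymbol f ((A : ℚ) / (C : ℚ) + (i : ℚ) / (p : ℚ))) = (p : ℂ) * y := by
  have hpp : (p : ℤ) ≠ 0 := by exact_mod_cast hp.out.ne_zero
  have hpprime : Prime (p : ℤ) := Nat.prime_iff_prime_int.mp hp.out
  -- complete `(A, C)` to `γ = (A B; C D)`
  obtain ⟨D, v₀, hDv⟩ := hAC
  set B : ℤ := -v₀ with hB
  have hdet : A * D - B * C = 1 := by rw [hB]; linear_combination hDv
  -- `C = p² c₂`, `D = A + p e`
  obtain ⟨c₂, hc₂⟩ : (p : ℤ) ^ 2 ∣ C := (Int.natCast_dvd_natCast.mpr hm |>.trans (by exact_mod_cast hLC) :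
    ((p ^ 2 : ℕ) : ℤ) ∣ C) |> fun h ↦ by exact_mod_cast h
  have hc₂0 : c₂ ≠ 0 := by rintro rfl; exact hC (by rw [hc₂, mul_zero])
  obtain ⟨e, he⟩ : (p : ℤ) ∣ D - A := by
    have h1 : (p : ℤ) ∣ A * (D - A) := by
      have : A * (D - A) = (A * D - B * C - 1) + B * C - (A * A - 1) := by ring
      rw [this, hdet, sub_self, zero_add, hc₂]
      exact dvd_sub (Dvd.intro (p * c₂ * B) (by ring)) hA
    rcases hpprime.dvd_or_dvd h1 with h | h
    · exfalso
      have : (p : ℤ) ∣ 1 := by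
        have e1 : (1 : ℤ) = A * A - (A * A - 1) := by ring
        rw [e1]; exact dvd_sub (dvd_mul_of_dvd_left h A) hA
      exact hp.out.ne_one (by exact_mod_cast Int.eq_one_of_dvd_one (by positivity) this)
    · exact h
  -- the conjugates `γ_n = u_n γ u_n⁻¹ ∈ SL(2, ℤ)`
  have hdetn : ∀ n : ℤ, !![A + n * (p * c₂), B + n * e - n ^ 2 * c₂; C, D - n * (p * c₂)].det = 1 := by
    intro n
    rw [Matrix.det_fin_two_of]
    linear_combination hdet + n * p * c₂ * he + (n ^ 2 * c₂ - n * e) * hc₂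
  let γn : ℤ → SL(2, ℤ) := fun n ↦ ⟨!![A + n * (p * c₂), B + n * e - n ^ 2 * c₂; C, D - n * (p * c₂)], hdetn n⟩
  have hγL : ∀ n, γn n ∈ Gamma0 L := fun n ↦ by
    rw [Gamma0_mem]
    change ((C : ℤ) : ZMod L) = 0
    exact (ZMod.intCast_zmod_eq_zero_iff_dvd C L).mpr hLC
  have hγN : ∀ n, γn n ∈ Gamma0 N := fun n ↦ by
    rw [Gamma0_mem]
    change ((C : ℤ) : ZMod N) = 0
    exact (ZMod.intCast_zmod_eq_zero_iff_dvd C N).mpr ((Int.natCast_dvd_natCast.mpr hN).trans hLC)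
  -- `γ_n ∞ = A/C + n/p`
  have hcusp : ∀ n : ℤ, (((γn n : SL(2, ℤ)) 0 0 : ℤ) : ℚ) / (((γn n : SL(2, ℤ)) 1 0 : ℤ) : ℚ) =
      (A : ℚ) / (C : ℚ) + (n : ℚ) / (p : ℚ) := by
    intro n
    change ((A + n * (p * c₂) : ℤ) : ℚ) / ((C : ℤ) : ℚ) = _
    have hpQ : (p : ℚ) ≠ 0 := by exact_mod_cast hp.out.ne_zero
    have hcQ : (c₂ : ℚ) ≠ 0 := by exact_mod_cast hc₂0
    rw [hc₂]
    push_cast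
    field_simp
  have hc10 : ∀ n, ((γn n : SL(2, ℤ)) 1 0) ≠ 0 := fun n ↦ by change C ≠ 0; exact hC
  -- the sequence `h(n) = {∞, A/C + n/p}_f`
  set h : ℤ → ℂ := fun n ↦ modularSymbol f ((A : ℚ) / (C : ℚ) + (n : ℚ) / (p : ℚ)) with hh
  have hmem : ∀ n, h n ∈ periodLattice f := by
    intro n
    have e1 : cuspSymbol f ⟨γn n, hγN n⟩ = h n := by
      show (if ((γn n : SL(2, ℤ)) 1 0) = 0 then 0 else modularSymbol f
        ((((γn n : SL(2, ℤ)) 0 0 : ℤ) : ℚ) / (((γn n : SL(2, ℤ)) 1 0 : ℤ) : ℚ))) = h n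
      rw [if_neg (hc10 n), hcusp]
    rw [← e1]
    exact cuspSymbol_mem_periodLattice f _
  have hper : ∀ n : ℤ, h (n + p) = h n := by
    intro n
    simp only [hh]
    have hpQ : (p : ℚ) ≠ 0 := by exact_mod_cast hp.out.ne_zero
    have e1 : (A : ℚ) / (C : ℚ) + ((n + p : ℤ) : ℚ) / (p : ℚ) = (A : ℚ) / (C : ℚ) + (n : ℚ) / (p : ℚ) + ((1 : ℤ) : ℚ) := by
      push_cast
      field_simp
      ring
    rw [e1, modularSymbol_add_intCast_holds f]
  -- BOTTOM at the periods `{∞, γ_j ∞}` of `f ⊗ χ`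
  have hbot' : ∀ j : ℤ, ∃ y ∈ periodLattice f,
      ∑ u : ZMod p, (quadraticChar (ZMod p) u : ℤ) • h (j + u.val) = (p : ℤ) • y := by
    intro j
    obtain ⟨y, hy, hyw⟩ := hbot _ (cuspSymbol_mem_periodLattice (charTwist L hN hm hχ f) ⟨γn j, hγL j⟩)
    refine ⟨y, hy, ?_⟩
    have hw : cuspSymbol (charTwist L hN hm hχ f) ⟨γn j, hγL j⟩ =
        modularSymbol (charTwist L hN hm hχ f) ((A : ℚ) / (C : ℚ) + (j : ℚ) / (p : ℚ)) := by
      show (if ((γn j : SL(2, ℤ)) 1 0) = 0 then 0 else modularSymbol (charTwist L hN hm hχ f)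
        ((((γn j : SL(2, ℤ)) 0 0 : ℤ) : ℚ) / (((γn j : SL(2, ℤ)) 1 0 : ℤ) : ℚ))) = _
      rw [if_neg (hc10 j), hcusp]
    rw [zsmul_eq_mul, Int.cast_natCast, ← hyw, hw, modularSymbol_charTwist, ← mul_assoc, mul_inv_cancel₀ hg,
      one_mul]
    refine Finset.sum_congr rfl fun u _ ↦ ?_
    rw [zsmul_eq_mul, hχL, hh]
    simp only
    congr 2
    rw [twistShift]
    push_cast
    ring
  -- conclude by the abstract transfer at `j = 0`
  obtain ⟨y, hy, e⟩ := horocyclic_transfer_abstract (periodLattice f) hp2 h hper hmem hbot' 0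
  refine ⟨y, hy, ?_⟩
  rw [zsmul_eq_mul, Int.cast_natCast] at e
  rw [← e]
  refine Finset.sum_congr rfl fun i _ ↦ ?_
  rw [zsmul_eq_mul, hh]
  simp only
  congr 2
  push_cast
  ring

end ModularSymbols

end Summit.BirchSwinnertonDyer.BirchSwinnertonDyer.Theorems

end
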